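import Literature.NumberTheory.EllipticCurves.Tian2014.CMPointSystemDescentPrimeSeven
import Literature.NumberTheory.EllipticCurves.Tian2014.CMPointSystemMonskyDescentOdd
import HarnessLib

/-!
# Tian 2014 Prop. 4.6 (= Monsky 1990 Thm. 4.9, the `p₇` case) transplanted onto the CM-point system: the ODD twist
# `m = p₀`, `p₀ ≡ 7 (mod 8)` — `2y_{p₀} ∈ E(ℚ(√−p₀))⁻ ∖ (2E(ℚ(√−p₀))⁻ + E[2])` from the printed system plus the printed
# sentences on `√2 ∈ H`

Cell `bsd-monsky` (prover-A seat, g13; `run/shared/lean/pub/bsd-monsky/`). HONEST FRAMING (README §1): nothing is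
asserted about BSD, nothing booked, no `_holds`; theorems on the data `D : CMPointData n` with Tian's printed properties as
hypotheses. NOTHING NEW ON PAPER: Tian proves Prop. 4.6 in print (Monsky [19] Thm. 4.9 with Lemma 4.8); with the siblings
`CMPointSystemDescentPrimeBase.lean` (`2p₃`) and `CMPointSystemDescentPrimeSeven.lean` (`2p₇`) this completes Prop. 4.6
on the data — all of Monsky's Cor. 5.15 (1) except `p₅` (whose CM-point system is Tian's `n ≡ 1 (mod 4)` construction,
not the `n ≡ 3 (mod 4)` data of `CMPointSystemDisplays.lean`).

## Source (verbatim, arXiv:1210.8231)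

* Prop. 4.6 proof, the rationality of `2y_m` for `m ≠ 2n` (p0023 L42–L45): "When `m ≠ 2n` choose an element
  `σ ∈ Gal(H(i)/K(i))` mapping `√−m` to `−√−m`, then both `σ` and the complex conjugation take `2y_m` to `−2y_m`, and
  therefore their composition fixes `2y_m` and has fixed field `ℚ(√−m)` in `K(√−m)`. This shows the claim and therefore it
  follows that `2y_m ∈ E(ℚ(√−m))⁻`."
* the `p₀ ≡ 7 mod 8` case (p0024 L6–L30), with `m = p₀` and `χ = χ_{p₀}` non-trivial: "`y^{σ_t}_{m,φ} = χ(t) y_{m,φ} +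
  (1, 0)` … `P^{σ_t} − χ(t)P = (1, 0)` … `P^{σ_t} − χ(t)P = (−1, 0)` or `(0, 0)` if `P = (1 + √2, 2 + √2) mod E[2]` according
  to `χ(t) = 1` or `−1`. It is a contradiction."
* §4.2 (p0022 L52, L69–L71): "`√2 ∈ H₀` but `i ∉ H`"; "by Gauss' genus theory, one can check that `σ_{ϖ′}|_H` fixes `√−p₀`
  and all `√p_i`".

## What is proved here (kernel), and from what

* `two_nsmul_yPointChi_eq_of_isReps`: `2y_{d,φ}` does not depend on the transversal (signed form);
* `exists_transferE_eq_two_nsmul_yPointChi`: `2y_{d,φ}` is the transfer along `θ′ = √−d` of a rational point of `E_d` for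
  EVERY transversal, with NO ambiguous class (Monsky's Thm. 4.7 device, used by the cell's `exists_transferE_eq_yPointChi`,
  is unavailable when `𝒜[2] = {1, [ϖ′]}`) — Galois bookkeeping on `2y` and Galois descent, Tian's sentence above;
* `act_art_yPointChi_eq_add_ptOne`: `σ_t(y_{d,φ}) = χ(t)·y_{d,φ} + (1,0)` on Tian's transversal (`n ≡ 7 (8)`);
* `exists_transferE_eq_two_nsmul_yPointChi_not_two_smul_add_torsion_seven`: the descent for the odd twist (`χ(t) = ±1`
  both handled: for `χ(t) = −1`, `σ_t(P) + P = (σ_t(P) − P) + 2P ≠ (1,0)` since `σ_t(P) ≠ P`);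
* `…_prime_seven_mod_eight`: for `n = p₀ ≡ 7 (8)` prime, with `θ′ := √−2p₀/√2`: every transversal, from `D.Printed` and
  FIVE printed sentences on `√2` as BINDERS — `hsq2` («`√2 ∈ H₀ ⊂ H`»), `hτ2` («`σ_{1+ϖ}` fixes `√2`»), `hc2` (conjugation fixes
  the real `√2`), `hπ2` («`σ_{ϖ′}|_H` fixes `√−p₀`», i.e. `√2`), `hgen` («`σ_t` moves `√2` for `[t] ∉ 2𝒜`»); no new named fact.

[cite: Tian2014, Prop. 4.6 and its proof (arXiv:1210.8231 p0023 L15–p0024 L30), §4.2 (p0022 L47–L71)]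
[cite: Monsky1990MockHeegner, Thm. 4.5 (p. 57), Lemma 4.8 and Thm. 4.9 (p. 58), Thm. 4.7 (pp. 57–58), Cor. 5.15 (1) (p. 66)] [cite: Cox2013, Prop. 3.11]
-/

noncomputable section

open scoped Classical

open WeierstrassCurve WeierstrassCurve.Affine NumberField Literature.NumberTheory.EllipticCurves
  Literature.NumberTheory.EllipticCurves.TianYuanZhang2017 Literature.NumberTheory.QuadraticFields.RedeiReichardt
open Literature.NumberTheory.EllipticCurves.Monsky1990 (map_sub_self_eq_zero_of_two_nsmul_eq_zero)

set_option autoImplicit false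

namespace Literature.NumberTheory.EllipticCurves.Tian2014

namespace CMPointData

variable {n : ℕ} (D : CMPointData n) {θ' : D.H} {c : ℚ} (hθ' : θ' ^ 2 = algebraMap ℚ D.H c)
  (hπθ' : D.art D.piPrime θ' = θ')

include hθ' hπθ' in
/-- **`2·y_{d,φ}` does not depend on the transversal** (signed form; the `2`-torsion shift of the change of
transversal is killed by `2`). [cite: Tian2014, §4.2 (p0022 L89–L94)] [cite: Monsky1990MockHeegner, Remark (p. 57)] -/
theorem two_nsmul_yPointChi_eq_of_isReps (h3 : D.thm28_3) (hπ : D.piPrime * D.piPrime = 1)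
    {φ φ' : Finset (ClassGroup (𝓞 (GenusField (2 * n))))} (hφ : D.IsRepsModPiPrime φ)
    (hφ' : D.IsRepsModPiPrime φ') : (2 : ℕ) • D.yPointChi θ' φ' = (2 : ℕ) • D.yPointChi θ' φ := by
  classical
  rw [D.yPointChi_eq_add_sum_of_isReps hθ' hπθ' h3 hπ hφ hφ', smul_add, Finset.sum_const, smul_comm]
  have hε2 : (2 : ℕ) • (if n % 8 = 7 then ptOne else ptNegOne : EPoint D.H) = 0 := by
    split_ifs
    · exact two_nsmul_ptOne
    · exact two_nsmul_ptNegOne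
  rw [hε2, smul_zero, add_zero]

/-- **`2·y_{d,φ}` is the transfer (along `θ′ = √−d`) of a rational point of `E_d`, for EVERY transversal** — Tian's
"`2y_m ∈ E(ℚ(√−m))⁻`" for `m ≠ 2n` ("choose `σ ∈ Gal(H(i)/K(i))` mapping `√−m` to `−√−m`; both `σ` and the complex
conjugation take `2y_m` to `−2y_m`, and therefore their composition fixes `2y_m` and has fixed field `ℚ(√−m)` in
`K(√−m)`"), with NO ambiguous class `B` (Monsky's Thm. 4.7 device is not available when `𝒜[2] = {1, [ϖ′]}`): Galois
bookkeeping on `2y` — `σ_s(2y) = χ(s)·2y`, `τ(2y) = 2y`, `conj(2y) = −2y` — through the `twistStabilizer` and Galois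
descent. Inputs: `θ′ ∈ H` with `θ′² = −d`, fixed by `σ_{[ϖ′]}` and `σ_{1+ϖ}`, negated by conjugation.
[cite: Tian2014, Prop. 4.6 proof (p0023 L26–L45)] [cite: Monsky1990MockHeegner, Thm. 4.5 proof (p. 57)] -/
theorem exists_transferE_eq_two_nsmul_yPointChi (hθ'0 : θ' ≠ 0) (hP : D.Printed) (d : ℕ)
    (hθ'd : θ' ^ 2 = algebraMap ℚ D.H (-(d : ℚ))) (hπθ'' : D.art D.piPrime θ' = θ') (hτθ' : D.tau θ' = θ')
    (hcθ' : D.conj θ' = -θ') {φ : Finset (ClassGroup (𝓞 (GenusField (2 * n))))} (hφ : D.IsRepsModPiPrime φ) :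
    ∃ y' : (congruentNumberCurve d).toAffine.Point, transferE d θ' hθ'd hθ'0 y' = (2 : ℕ) • D.yPointChi θ' φ := by
  classical
  obtain ⟨h1, h2, h3, h48, hart, ⟨htaui, htauθ, htau2⟩, ⟨hconji, hconjθ, hconj2⟩, -, hgalK, hπ, -⟩ := hP
  have hne : -θ' ≠ θ' := by
    intro h'
    have h2' : (2 : D.H) * θ' = 0 := by linear_combination -h'
    rcases mul_eq_zero.mp h2' with h3' | h3'
    · exact two_ne_zero h3'
    · exact hθ'0 h3'
  set y : EPoint D.H := (2 : ℕ) • D.yPointChi θ' φ with hy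
  have hz2 : ∀ k : ℕ, (2 : ℕ) • (k • (ptZero : EPoint D.H)) = 0 := fun k => by
    rw [smul_comm, two_nsmul_ptZero, smul_zero]
  have ho2 : ∀ k : ℕ, (2 : ℕ) • (k • (ptOne : EPoint D.H)) = 0 := fun k => by
    rw [smul_comm, two_nsmul_ptOne, smul_zero]
  -- the three generators
  have htau : D.act D.tau y = y := by
    rw [hy, map_nsmul, D.act_tau_yPointChi h1, Finset.sum_const, smul_add, hz2, add_zero]
  have hσ : ∀ s, D.act (D.art s) y = D.chi θ' s • y := by
    intro s
    rw [hy, map_nsmul, D.act_art_yPointChi hθ'd h48, smul_comm,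
      D.two_nsmul_yPointChi_eq_of_isReps hθ'd hπθ'' h3 hπ hφ (D.isRepsModPiPrime_image_mul hφ s)]
  have hconj : D.act D.conj y = -y := by
    rw [hy, map_nsmul, D.act_conj_yPointChi hθ'd h2, Finset.sum_const, smul_add, ho2, add_zero, smul_neg,
      D.two_nsmul_yPointChi_eq_of_isReps hθ'd hπθ'' h3 hπ hφ (D.isRepsModPiPrime_image_inv hπ hφ)]
  have hle : Subgroup.closure (Set.range D.art ∪ {D.tau}) ≤ D.twistStabilizer hθ'd hθ'0 y := by
    rw [Subgroup.closure_le]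
    rintro σ (⟨s, rfl⟩ | hσ')
    · refine ⟨fun h => ?_, fun h => ?_⟩
      · rw [hσ s]; unfold chi; rw [if_pos h, one_zsmul]
      · rw [hσ s]; unfold chi; rw [if_neg (by rw [h]; exact hne), neg_one_zsmul]
    · rw [Set.mem_singleton_iff] at hσ'
      rw [hσ']
      exact ⟨fun _ => htau, fun h => absurd (hτθ'.symm.trans h) hne.symm⟩
  have hfix : ∀ g : D.H ≃ₐ[ℚ] D.H, g θ' = θ' → D.act g y = y := by
    intro g hg
    rcases D.gal_theta'_eq_or_eq_neg D.sqrtNegTwoN_sq' g with hgθ | hgθ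
    · exact (hle (hgalK g hgθ)).1 hg
    · have h' : (D.conj * g) D.sqrtNegTwoN = D.sqrtNegTwoN := by
        rw [AlgEquiv.mul_apply, hgθ, map_neg, hconjθ, neg_neg]
      have h'' : (D.conj * g) θ' = -θ' := by rw [AlgEquiv.mul_apply, hg, hcθ']
      have := (hle (hgalK _ h')).2 h''
      rw [D.act_mul] at this
      have h3' := congrArg (D.act D.conj) this
      rw [← D.act_mul, hconj2, D.act_one, map_neg, hconj, neg_neg] at h3'
      exact h3'
  have hneg : ∀ g : D.H ≃ₐ[ℚ] D.H, g θ' = -θ' → D.act g y = -y := by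
    intro g hg
    rcases D.gal_theta'_eq_or_eq_neg D.sqrtNegTwoN_sq' g with hgθ | hgθ
    · exact (hle (hgalK g hgθ)).2 hg
    · have h' : (D.conj * g) D.sqrtNegTwoN = D.sqrtNegTwoN := by
        rw [AlgEquiv.mul_apply, hgθ, map_neg, hconjθ, neg_neg]
      have h'' : (D.conj * g) θ' = θ' := by rw [AlgEquiv.mul_apply, hg, map_neg, hcθ', neg_neg]
      have := (hle (hgalK _ h')).1 h''
      rw [D.act_mul] at this
      have h3' := congrArg (D.act D.conj) this
      rw [← D.act_mul, hconj2, D.act_one, hconj] at h3'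
      exact h3'
  exact exists_transferE_eq_of_forall_gal d θ' hθ'd hθ'0 y hfix hneg

include hθ' hπθ' in
/-- **`σ_t(y_{d,φ}) = χ(t)·y_{d,φ} + (1,0)` for Tian's transversal** (signed form, `n ≡ 7 (8)`; Tian p0024 L20–L25:
"`y^{σ_t}_{m,φ} = χ(t)(Σ_φ χ(t′)z_{t′} + Σ_{φ₀} χ(t′)(z_{ϖ′t′} − z_{t′})) = χ(t)y_{m,φ} + (1,0)`").
[cite: Tian2014, Prop. 4.6 proof (p0024 L20–L25)] -/
theorem act_art_yPointChi_eq_add_ptOne (hn8 : n % 8 = 7) (h3 : D.thm28_3) (h48 : D.eq48)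
    (t : ClassGroup (𝓞 (GenusField (2 * n)))) {φ φ₀ : Finset (ClassGroup (𝓞 (GenusField (2 * n))))} {m : ℕ}
    (htm : t ^ m = D.piPrime) (hodd : Odd φ₀.card)
    (hsum : ∀ {M : Type} [AddCommGroup M] (f : ClassGroup (𝓞 (GenusField (2 * n))) → M),
      ∑ a ∈ φ, f a = ∑ i ∈ Finset.range m, ∑ u ∈ φ₀, f (t ^ i * u)) :
    D.act (D.art t) (D.yPointChi θ' φ) = D.chi θ' t • D.yPointChi θ' φ + ptOne := by
  classical
  rw [D.act_art_yPointChi hθ' h48]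
  set g : ℕ → EPoint D.H := fun i => ∑ u ∈ φ₀, D.chi θ' (t ^ i * u) • D.z (t ^ i * u) with hg
  have hL : D.yPointChi θ' (φ.image (fun a => t * a)) = ∑ i ∈ Finset.range m, g (i + 1) := by
    rw [yPointChi, Finset.sum_image (fun a _ b _ hab => mul_left_cancel hab),
      hsum (fun a => D.chi θ' (t * a) • D.z (t * a))]
    exact Finset.sum_congr rfl (fun i _ => Finset.sum_congr rfl (fun u _ => by rw [pow_succ', mul_assoc]))
  have hR : D.yPointChi θ' φ = ∑ i ∈ Finset.range m, g i := by
    rw [yPointChi, hsum (fun a => D.chi θ' a • D.z a)]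
  have htele : ∑ i ∈ Finset.range m, g (i + 1) = ∑ i ∈ Finset.range m, g i + (g m - g 0) := by
    have e1 := Finset.sum_range_succ g m
    have e2 := Finset.sum_range_succ' g m
    rw [e2] at e1
    rw [eq_sub_iff_add_eq.mpr e1.symm]
    abel
  have hdiff : g m - g 0 = ptOne := by
    rw [hg]
    simp only [pow_zero, one_mul, htm]
    rw [← Finset.sum_sub_distrib]
    have hterm : ∀ u ∈ φ₀, D.chi θ' (D.piPrime * u) • D.z (D.piPrime * u) - D.chi θ' u • D.z u = ptOne := by
      intro u _
      rw [D.chi_piPrime_mul hθ' hπθ', ← smul_sub, h3 u, if_pos hn8,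
        D.chi_smul_of_two_nsmul_eq_zero θ' u two_nsmul_ptOne]
    rw [Finset.sum_congr rfl hterm, Finset.sum_const, odd_nsmul_of_two_nsmul_eq_zero two_nsmul_ptOne hodd]
  rw [hL, htele, hdiff, ← hR, smul_add, D.chi_smul_of_two_nsmul_eq_zero θ' t two_nsmul_ptOne]

omit hθ' hπθ' in
/-- **Tian Prop. 4.6, the `p₀ ≡ 7 (mod 8)` ODD twist `m = p₀`, on the data**: with `θ′ = √−n ∈ H` (`n ≡ 7 (8)`, `χ = χ_n`
non-trivial), `𝒜[2] = {1, [ϖ′]}`, `σ_{1+ϖ}` fixing the square roots of `2`, `σ_t` negating them for every non-square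
`t`, `θ′` fixed by `σ_{[ϖ′]}` and `σ_{1+ϖ}` and negated by conjugation: for EVERY transversal `φ`, the rational point
`y″ ∈ E_n(ℚ)` with `transfer_{θ′} y″ = 2y_{n,φ}` is NOT of the form `2z + t`. Tian p0024 L6–L30 with `χ` non-trivial:
on Tian's transversal `ψ`, `P := y_ψ − S` has `σ_t(P) − χ(t)P = (1,0)`; if `#ψ` is odd `σ_{1+ϖ}(P) − P = (0,0)`
(impossible); if `#ψ` is even `σ_{1+ϖ}` fixes `P`, so `2P ∈ {O, (1,0)}`, and `σ_t(P) − χ(t)P = (1,0)` is impossible: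
for `χ(t) = 1` as in the even twist; for `χ(t) = −1`, `σ_t(P) + P = (σ_t(P) − P) + 2P ≠ (1,0)` since `σ_t(P) ≠ P`.
[cite: Tian2014, Prop. 4.6 (p0023 L15–L22) and its proof (p0024 L6–L30)] -/
theorem exists_transferE_eq_two_nsmul_yPointChi_not_two_smul_add_torsion_seven (hn8 : n % 8 = 7)
    (hsqn : Squarefree n) (hP : D.Printed) (hθ'n : θ' ^ 2 = algebraMap ℚ D.H (-(n : ℚ))) (hθ'0 : θ' ≠ 0)
    (hπθ'' : D.art D.piPrime θ' = θ') (hτθ' : D.tau θ' = θ') (hcθ' : D.conj θ' = -θ')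
    (hτ2 : ∀ s : D.H, s ^ 2 = 2 → D.tau s = s)
    (hgen : ∀ t : ClassGroup (𝓞 (GenusField (2 * n))), ¬ IsSquare t → ∀ s : D.H, s ^ 2 = 2 → D.art t s = -s)
    (h2 : ∀ u : ClassGroup (𝓞 (GenusField (2 * n))), u * u = 1 → u = 1 ∨ u = D.piPrime)
    {φ : Finset (ClassGroup (𝓞 (GenusField (2 * n))))} (hφ : D.IsRepsModPiPrime φ) :
    ∃ y' : (congruentNumberCurve n).toAffine.Point, transferE n θ' hθ'n hθ'0 y' = (2 : ℕ) • D.yPointChi θ' φ ∧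
      ∀ z t : (congruentNumberCurve n).toAffine.Point, IsOfFinAddOrder t → y' ≠ (2 : ℤ) • z + t := by
  classical
  have hP' := hP
  obtain ⟨h1, -, h3, h48, hart, ⟨htaui, -, -⟩, -, -, -, hπ, hπ1⟩ := hP'
  obtain ⟨t, ht⟩ := exists_not_isSquare_of_mul_self_eq_one D.piPrime hπ hπ1
  obtain ⟨ψ, ψ₀, m, -, htm, hodd₀, hψ, hsum⟩ := exists_special_transversal D.piPrime h2 t ht
  have h2y : (2 : ℕ) • D.yPointChi θ' φ = (2 : ℕ) • D.yPointChi θ' ψ :=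
    D.two_nsmul_yPointChi_eq_of_isReps hθ'n hπθ'' h3 hπ hψ hφ
  obtain ⟨y', hy'⟩ := D.exists_transferE_eq_two_nsmul_yPointChi hθ'0 hP n hθ'n hπθ'' hτθ' hcθ' hψ
  refine ⟨y', by rw [hy', h2y], ?_⟩
  intro z t₀ ht₀ heq
  have ht2 : (2 : ℕ) • t₀ = 0 := two_nsmul_eq_zero_of_isOfFinAddOrder_congruentNumberCurve hsqn ht₀
  set S : EPoint D.H := transferE n θ' hθ'n hθ'0 z with hS
  set T : EPoint D.H := transferE n θ' hθ'n hθ'0 t₀ with hT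
  have hyST : (2 : ℕ) • D.yPointChi θ' ψ = (2 : ℕ) • S + T := by
    rw [← hy', heq, map_add, map_zsmul, two_zsmul, two_nsmul]
  have hT2 : (2 : ℕ) • T = 0 := by rw [hT, ← map_nsmul, ht2, map_zero]
  set P : EPoint D.H := D.yPointChi θ' ψ - S with hPdef
  have h2P : (2 : ℕ) • P = T := by rw [hPdef, smul_sub, hyST]; abel
  have h4P : (2 : ℕ) • ((2 : ℕ) • P) = 0 := by rw [h2P, hT2]
  have hSτ : D.act D.tau S = S := by
    rw [hS]; exact act_transferE_of_fix n _ _ _ _ hτθ' z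
  -- `σ_t(S) = χ(t)·S`
  have hSσ : D.act (D.art t) S = D.chi θ' t • S := by
    rw [hS]
    unfold chi
    split_ifs with hfix
    · rw [one_zsmul]; exact act_transferE_of_fix n _ _ _ _ hfix z
    · rw [neg_one_zsmul]
      rcases D.gal_theta'_eq_or_eq_neg hθ'n (D.art t) with h | h
      · exact absurd h hfix
      · exact act_transferE_of_neg n _ _ _ _ h z
  -- `σ_t(P) − χ(t)P = (1,0)`
  have hσP : D.act (D.art t) P - D.chi θ' t • P = ptOne := by
    rw [hPdef, map_sub, hSσ, D.act_art_yPointChi_eq_add_ptOne hθ'n hπθ'' hn8 h3 h48 t htm hodd₀ hsum, smul_sub]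
    abel
  rcases Nat.even_or_odd ψ.card with ⟨k, hk⟩ | hodd
  · -- `#ψ` even: `σ_{1+ϖ}` fixes `P`, so `2P ∈ {O, (1,0)}`
    have hz : (k + k) • (ptZero : EPoint D.H) = 0 := by
      rw [add_nsmul, ← smul_add, ← two_nsmul, two_nsmul_ptZero, smul_zero]
    have hyτ : D.act D.tau (D.yPointChi θ' ψ) = D.yPointChi θ' ψ := by
      rw [D.act_tau_yPointChi h1, Finset.sum_const, hk, hz, add_zero]
    have hPτ : D.act D.tau P = P := by rw [hPdef, map_sub, hSτ, hyτ]
    rcases two_nsmul_eq_zero_or_ptOne_of_map_eq_self D.tau D.im D.im_sq htaui hτ2 P h4P hPτ with h0 | h1'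
    · -- `P ∈ E[2]`: `σ_t(P) = P`, so `σ_t(P) − χ(t)P ∈ {O, 2P = O}`
      have hfixP : D.act (D.art t) P - P = 0 := map_sub_self_eq_zero_of_two_nsmul_eq_zero (D.art t) P h0
      rw [sub_eq_zero] at hfixP
      rw [hfixP] at hσP
      rcases D.chi_eq_one_or_neg_one θ' t with hc | hc <;> rw [hc] at hσP
      · rw [one_zsmul, sub_self] at hσP
        exact Point.some_ne_zero _ hσP.symm
      · rw [neg_one_zsmul, sub_neg_eq_add, ← two_nsmul, h0] at hσP
        exact Point.some_ne_zero _ hσP.symm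
    · -- `2P = (1,0)`: `σ_t(P) − P ∉ {O, (1,0)}`
      obtain ⟨hne0, hne1⟩ := map_sub_ne_zero_and_ne_ptOne_of_two_nsmul_eq_ptOne (D.art t) (hgen t ht) P h1'
      rcases D.chi_eq_one_or_neg_one θ' t with hc | hc <;> rw [hc] at hσP
      · rw [one_zsmul] at hσP
        exact hne1 hσP
      · rw [neg_one_zsmul, sub_neg_eq_add] at hσP
        apply hne0
        show D.act (D.art t) P - P = 0
        have : D.act (D.art t) P - P = D.act (D.art t) P + P - (2 : ℕ) • P := by rw [two_nsmul]; abel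
        rw [this, hσP, h1', sub_self]
  · -- `#ψ` odd: `σ_{1+ϖ}(P) − P = (0,0)`, impossible
    have hyτ : D.act D.tau (D.yPointChi θ' ψ) = D.yPointChi θ' ψ + ptZero := by
      rw [D.act_tau_yPointChi h1, Finset.sum_const, odd_nsmul_of_two_nsmul_eq_zero two_nsmul_ptZero hodd]
    have hPτ : D.act D.tau P - P = ptZero := by
      rw [hPdef, map_sub, hSτ, hyτ]; abel
    exact map_sub_ne_ptZero_of_two_nsmul_two_nsmul_eq_zero D.tau D.im D.im_sq htaui hτ2 P h4P hPτ

omit hθ' hπθ' in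
/-- **Tian Prop. 4.6, the `p₀ ≡ 7 (mod 8)` ODD twist `m = p₀`, for `n = p₀` prime, every transversal**: from `D.Printed`
and the printed sentences on `√2 ∈ H` («`√2 ∈ H₀`», p0022 L52: `hsq2`; «`σ_{1+ϖ}` fixes `√2`», p0024 L1: `hτ2`; «`σ_{ϖ′}|_H fixes
`√−p₀`» ⟺ fixes `√2 = √−2p₀/√−p₀`, p0022 L69–L71: `hπ2`; complex conjugation fixes the real `√2`: `hc2`; «`σ_t` moves `√2`
for `[t] ∉ 2𝒜`», p0024 L26: `hgen`) ALONE, with `θ′ := √−2p₀/√2` a square root of `−p₀`: a transversal exists, and for every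
transversal `φ` the rational point `y″ ∈ E_{p₀}(ℚ)` with `transfer_{θ′} y″ = 2y_{p₀,φ}` lies outside `2E_{p₀}(ℚ) + tor`
(Monsky Thm. 4.9 / Cor. 5.15 (1) «`p₇`», for Tian's point; Lemma 4.8's transversal). `𝒜[2] = {1, [ϖ′]}` is Gauss (a tree theorem).
[cite: Tian2014, Prop. 4.6 (p0023 L15–L22) and its proof (p0024 L6–L30), §4.2 (p0022 L47–L71)]
[cite: Monsky1990MockHeegner, Lemma 4.8 and Thm. 4.9 (p. 58), Cor. 5.15 (1) (p. 66)] -/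
theorem exists_transferE_eq_two_nsmul_yPointChi_not_two_smul_add_torsion_prime_seven_mod_eight
    (hn : n.Prime) (hn8 : n % 8 = 7) (hP : D.Printed) (hsq2 : ∃ s : D.H, s ^ 2 = 2)
    (hτ2 : ∀ s : D.H, s ^ 2 = 2 → D.tau s = s) (hc2 : ∀ s : D.H, s ^ 2 = 2 → D.conj s = s)
    (hπ2 : ∀ s : D.H, s ^ 2 = 2 → D.art D.piPrime s = s)
    (hgen : ∀ t : ClassGroup (𝓞 (GenusField (2 * n))), ¬ IsSquare t → ∀ s : D.H, s ^ 2 = 2 → D.art t s = -s) :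
    ∃ (θ' : D.H) (hθ' : θ' ^ 2 = algebraMap ℚ D.H (-(n : ℚ))) (hθ'0 : θ' ≠ 0),
      (∃ φ, D.IsRepsModPiPrime φ) ∧
      ∀ φ : Finset (ClassGroup (𝓞 (GenusField (2 * n)))), D.IsRepsModPiPrime φ →
        ∃ y' : (congruentNumberCurve n).toAffine.Point,
          transferE n θ' hθ' hθ'0 y' = (2 : ℕ) • D.yPointChi θ' φ ∧
          ∀ z t : (congruentNumberCurve n).toAffine.Point, IsOfFinAddOrder t → y' ≠ (2 : ℤ) • z + t := by
  classical
  have hP' := hP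
  obtain ⟨-, -, -, -, hart, ⟨-, htauθ, -⟩, ⟨-, hconjθ, -⟩, -, -, hπ, hπ1⟩ := hP'
  obtain ⟨s, hs⟩ := hsq2
  have hs0 : s ≠ 0 := by intro h; rw [h] at hs; norm_num at hs
  have hn2 : n ≠ 2 := by rintro rfl; norm_num at hn8
  -- `θ′ := √−2n / √2`
  set θ' : D.H := D.sqrtNegTwoN / s with hθ'def
  have hθ' : θ' ^ 2 = algebraMap ℚ D.H (-(n : ℚ)) := by
    rw [hθ'def, div_pow, D.sqrtNegTwoN_sq, hs, map_neg, map_natCast]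
    push_cast
    field_simp
  have hθ'0 : θ' ≠ 0 := by
    rw [hθ'def]
    exact div_ne_zero (D.sqrtNegTwoN_ne_zero hn.ne_zero) hs0
  have hπθ' : D.art D.piPrime θ' = θ' := by rw [hθ'def, map_div₀, (hart _).2, hπ2 s hs]
  have hτθ' : D.tau θ' = θ' := by rw [hθ'def, map_div₀, htauθ, hτ2 s hs]
  have hcθ' : D.conj θ' = -θ' := by rw [hθ'def, map_div₀, hconjθ, hc2 s hs, neg_div]
  have hsqn : Squarefree n := hn.prime.squarefree
  have h2 := eq_one_or_eq_of_mul_self_eq_one_of_natCard_eq_two D.piPrime hπ hπ1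
    (natCard_sq_eq_one_classGroup_genusField_two_mul_prime hn hn2)
  refine ⟨θ', hθ', hθ'0, exists_isReps_of_mul_self_eq_one D.piPrime hπ hπ1, fun φ hφ => ?_⟩
  exact D.exists_transferE_eq_two_nsmul_yPointChi_not_two_smul_add_torsion_seven hn8 hsqn hP hθ' hθ'0
    hπθ' hτθ' hcθ' hτ2 hgen h2 hφ

end CMPointData

end Literature.NumberTheory.EllipticCurves.Tian2014

end
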